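import Literature.AlgebraicGeometry.Resolution.AlterationsProofs
import Literature.AlgebraicGeometry.Resolution.AlterationsResolution
import Literature.AlgebraicGeometry.Resolution.SurfaceResolutionReduction
import HarnessLib

/-!
# Purely inseparable alterations: composition, birational maps, reduction to normal varieties

Topic: `Literature/AlgebraicGeometry/Resolution`. Companion to `Alterations.lean` /
`AlterationsResolution.lean` (the open Abramovich–Oort conjecture `AbramovichOortConjecture`:
every integral variety has a purely inseparable alteration with regular source, Temkin 2013,
Conj. 1.3.1) and to `AlterationsProofs.lean` (`IsAlteration.comp`, de Jong 1996, 2.20). All proved.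

## Content

* `universallyInjective_morphismRestrict_of_le` — radiciality over an open `V` of the target
  restricts to every smaller open (base change), companion of `isFinite_morphismRestrict_of_le`.
* `IsPurelyInseparableAlteration.comp` — **a composition of purely inseparable alterations is a
  purely inseparable alteration** (de Jong 1996, 2.20 for alterations; purely inseparable
  extensions of function fields compose): with `φ` finite radicial over `U` and `ψ` over `V`, the
  composite is finite radicial over `U ∖ φ(X' ∖ V)`, which contains the generic point.
* `IsBirational.isPurelyInseparableAlteration` — a proper birational morphism between integral
  schemes is a purely inseparable alteration (generalising
  `IsResolution.isPurelyInseparableAlteration`, which also asks the source to be regular).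
* `isPurelyInseparableAlteration_normalizationι` — the normalisation `X^ν → X` of a variety is a
  purely inseparable (indeed birational, finite) alteration.
* `exists_isPurelyInseparableAlteration_of_isPurelyInseparableAlteration` — the conclusion of the
  conjecture descends along a purely inseparable alteration `X' → X`: a regular purely
  inseparable alteration of `X'` is one of `X`.
* `abramovichOort_of_forall_normal` — **reduction to normal varieties**: over a fixed field `k`,
  if every NORMAL integral separated `k`-scheme of finite type (all stalks integrally closed) has
  a regular purely inseparable alteration, then so has every integral separated `k`-scheme of
  finite type (normalise first; Zariski's classical first step).

## Sources

* A. J. de Jong, *Smoothness, semi-stability and alterations*, Publ. Math. IHÉS 83 (1996), 2.20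
  ("A composition of alterations is an alteration").
* M. Temkin, *Inseparable local uniformization*, J. Algebra 373 (2013) (= arXiv:0804.1554v3),
  §1.2–1.3 (alterations, Conj. 1.3.1), §1 p. 3 (i) ⊂ (iii).
* The Stacks Project, Tags 01S2/01S4 (universally injective = radicial, stable under base
  change and composition), 035E (normalization), 0BXR/01RN (birational).
-/

noncomputable section

open CategoryTheory AlgebraicGeometry TopologicalSpace Topology

namespace Literature.AlgebraicGeometry.Resolution

universe u

/-! ## Radiciality over smaller opens -/

/-- Universal injectivity over an open `V` of the target passes to every smaller open `U ≤ V`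
(base change of `f ∣_ V` along the open immersion `U ↪ V`; Stacks, Tag 01S4). [folklore] -/
theorem universallyInjective_morphismRestrict_of_le {X Y : Scheme.{u}} (f : X ⟶ Y)
    {U V : Y.Opens} (e : U ≤ V) [UniversallyInjective (f ∣_ V)] :
    UniversallyInjective (f ∣_ U) := by
  have sq : IsPullback (X.homOfLE (f.preimage_mono e)) (f ∣_ U) (f ∣_ V) (Y.homOfLE e) := by
    refine IsPullback.of_right (h₁₂ := (f ⁻¹ᵁ V).ι) (h₂₂ := V.ι) ?_
      (morphismRestrict_homOfLE f U V e).symm (isPullback_morphismRestrict f V).flip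
    simpa only [Scheme.homOfLE_ι] using (isPullback_morphismRestrict f U).flip
  exact MorphismProperty.of_isPullback sq ‹_›

/-! ## Composition (de Jong 1996, 2.20, purely inseparable version) -/

/-- **A composition of purely inseparable alterations is a purely inseparable alteration**
(de Jong 1996, 2.20 for alterations; finite radicial morphisms are stable under composition and
base change). If `ψ : X'' → X'` and `φ : X' → X` are purely inseparable alterations (`X`
integral) then so is `ψ ≫ φ`: with `φ` finite radicial over `U` and `ψ` over `V`, the composite is
finite radicial over the open `U ∖ φ(X' ∖ V)`, which contains the generic point of `X` because the
only point of `φ⁻¹(U)` above it is the generic point of `X'`, a point of `V`.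
[cite: DeJong1996, 2.20] -/
theorem IsPurelyInseparableAlteration.comp {X'' X' X : Scheme.{u}} {ψ : X'' ⟶ X'} {φ : X' ⟶ X}
    [IsIntegral X] (hψ : IsPurelyInseparableAlteration ψ) (hφ : IsPurelyInseparableAlteration φ) :
    IsPurelyInseparableAlteration (ψ ≫ φ) := by
  haveI := hψ.isIntegral
  haveI := hφ.isIntegral
  haveI := hψ.isProper
  haveI := hφ.isProper
  haveI := hψ.isDominant
  haveI := hφ.isDominant
  refine ⟨inferInstance, inferInstance, inferInstance, ?_⟩
  obtain ⟨U, hU, hUfin, hUui⟩ := hφ.exists_isFinite_universallyInjective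
  obtain ⟨V, hV, hVfin, hVui⟩ := hψ.exists_isFinite_universallyInjective
  -- the closed set of `X` over which `φ⁻¹` leaves `V`
  have hC : IsClosed (φ '' (V : Set X')ᶜ) := φ.isClosedMap _ V.isOpen.isClosed_compl
  let W : X.Opens := ⟨(U : Set X) \ φ '' (V : Set X')ᶜ, U.isOpen.sdiff hC⟩
  have hWU : W ≤ U := fun _ hx => hx.1
  have hWV : φ ⁻¹ᵁ W ≤ V := by
    intro x hx
    by_contra hxV
    exact hx.2 ⟨x, hxV, rfl⟩
  refine ⟨W, ?_, ?_, ?_⟩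
  · -- the generic point of `X` lies in `W`
    refine ⟨genericPoint X, ?_, ?_⟩
    · exact ((genericPoint_spec X).mem_open_set_iff U.isOpen).mpr (by simpa using hU)
    · rintro ⟨x', hx'V, hx'⟩
      haveI := hUfin
      have hx'U : x' ∈ φ ⁻¹ᵁ U := by
        show φ x' ∈ U
        rw [hx']
        exact ((genericPoint_spec X).mem_open_set_iff U.isOpen).mpr (by simpa using hU)
      have := eq_genericPoint_of_isFinite_restrict φ U hx'U hx'
      apply hx'V
      rw [this]
      exact ((genericPoint_spec X').mem_open_set_iff V.isOpen).mpr (by simpa using hV)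
  · rw [morphismRestrict_comp]
    exact MorphismProperty.comp_mem _ _ _ (isFinite_morphismRestrict_of_le ψ hWV)
      (isFinite_morphismRestrict_of_le φ hWU)
  · rw [morphismRestrict_comp]
    exact MorphismProperty.comp_mem _ _ _ (universallyInjective_morphismRestrict_of_le ψ hWV)
      (universallyInjective_morphismRestrict_of_le φ hWU)

/-! ## Birational proper morphisms and the normalisation -/

/-- **A proper birational morphism of integral schemes is a purely inseparable alteration**
(Temkin 2013, §1 p. 3, (i) ⊂ (iii) without the regularity of the source): it is dominant, and
over the dense open `U` where it is an isomorphism it is finite and radicial.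
[cite: Temkin2013, §1 p. 3 (i), (iii)] -/
theorem IsBirational.isPurelyInseparableAlteration {X' X : Scheme.{u}} {π : X' ⟶ X}
    [IsIntegral X] [IsIntegral X'] [IsProper π] (h : IsBirational π) :
    IsPurelyInseparableAlteration π := by
  haveI : IsDominant π := h.isDominant
  refine ⟨inferInstance, inferInstance, inferInstance, ?_⟩
  obtain ⟨U, hU, -, hiso⟩ := h
  exact ⟨U, hU.nonempty, inferInstance, inferInstance⟩

/-- **The normalisation of a variety is a purely inseparable alteration**: for an integral scheme
`X` locally of finite type over a field, `X^ν → X` is finite (E. Noether,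
`NoetherFiniteIntegralClosure_holds`), hence proper, and birational
(`isBirational_normalizationι`). [folklore] -/
theorem isPurelyInseparableAlteration_normalizationι (X : Scheme.{u}) [IsIntegral X]
    {k : Type u} [Field k] (f : X ⟶ Spec (.of k)) [LocallyOfFiniteType f] :
    IsPurelyInseparableAlteration (normalizationι X) := by
  haveI : IsFinite (normalizationι X) :=
    isFinite_normalizationι X NoetherFiniteIntegralClosure_holds f
  exact (isBirational_normalizationι X f).isPurelyInseparableAlteration

/-! ## Descending the conclusion of the conjecture; reduction to normal varieties -/

/-- The conclusion of the Abramovich–Oort conjecture descends along a purely inseparable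
alteration `φ : X' → X`: a purely inseparable alteration `ψ : Y → X'` with `Y` regular gives the
purely inseparable alteration `ψ ≫ φ : Y → X`. [cite: DeJong1996, 2.20] -/
theorem exists_isPurelyInseparableAlteration_of_isPurelyInseparableAlteration
    {X' X : Scheme.{u}} [IsIntegral X] {φ : X' ⟶ X} (hφ : IsPurelyInseparableAlteration φ)
    (h : ∃ (Y : Scheme.{u}) (ψ : Y ⟶ X'), IsPurelyInseparableAlteration ψ ∧ Scheme.IsRegular Y) :
    ∃ (Y : Scheme.{u}) (ψ : Y ⟶ X), IsPurelyInseparableAlteration ψ ∧ Scheme.IsRegular Y := by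
  haveI := hφ.isIntegral
  obtain ⟨Y, ψ, hψ, hreg⟩ := h
  exact ⟨Y, ψ ≫ φ, hψ.comp hφ, hreg⟩

/-- **Reduction of the Abramovich–Oort conjecture to normal varieties** (normalise first — the
classical first step of Zariski): over a field `k`, if every integral NORMAL (all local rings
integrally closed) separated `k`-scheme of finite type admits a purely inseparable alteration with
regular source, then so does every integral separated `k`-scheme of finite type `X`: apply the
hypothesis to `X^ν` (integral, normal by `isIntegrallyClosed_stalk_normalization`, finite over `X`
hence again separated and of finite type over `k`) and compose with `X^ν → X`
(`isPurelyInseparableAlteration_normalizationι`). [folklore] -/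
theorem abramovichOort_of_forall_normal (k : Type u) [Field k]
    (h : ∀ (X : Scheme.{u}) (f : X ⟶ Spec (.of k)),
      IsSeparated f → LocallyOfFiniteType f → QuasiCompact f → IsIntegral X →
        (∀ x : X, IsIntegrallyClosed (X.presheaf.stalk x)) →
          ∃ (Y : Scheme.{u}) (φ : Y ⟶ X), IsPurelyInseparableAlteration φ ∧ Scheme.IsRegular Y)
    (X : Scheme.{u}) (f : X ⟶ Spec (.of k)) [IsSeparated f] [LocallyOfFiniteType f]
    [QuasiCompact f] [IsIntegral X] :
    ∃ (Y : Scheme.{u}) (φ : Y ⟶ X), IsPurelyInseparableAlteration φ ∧ Scheme.IsRegular Y := by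
  haveI : IsFinite (normalizationι X) :=
    isFinite_normalizationι X NoetherFiniteIntegralClosure_holds f
  refine exists_isPurelyInseparableAlteration_of_isPurelyInseparableAlteration
    (isPurelyInseparableAlteration_normalizationι X f) ?_
  exact h (normalization X) (normalizationι X ≫ f) inferInstance inferInstance inferInstance
    inferInstance (isIntegrallyClosed_stalk_normalization X)

/-- The same reduction inside the conjecture: `AbramovichOortConjecture` is equivalent to its
restriction to normal varieties. [folklore] -/
theorem abramovichOortConjecture_iff_forall_normal :
    AbramovichOortConjecture.{u} ↔
      ∀ (k : Type u) [Field k] (X : Scheme.{u}) (f : X ⟶ Spec (.of k)),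
        IsSeparated f → LocallyOfFiniteType f → QuasiCompact f → IsIntegral X →
          (∀ x : X, IsIntegrallyClosed (X.presheaf.stalk x)) →
            ∃ (Y : Scheme.{u}) (φ : Y ⟶ X), IsPurelyInseparableAlteration φ ∧ Scheme.IsRegular Y := by
  refine ⟨fun h k _ X f hs hl hq hi _ => h k X f hs hl hq hi, fun h k _ X f hs hl hq hi => ?_⟩
  haveI := hs; haveI := hl; haveI := hq; haveI := hi
  exact abramovichOort_of_forall_normal k (h k) X f

/-- A purely inseparable alteration of a variety over `k` preserves the dimension
(`IsAlteration.topologicalKrullDim_eq`). [cite: DeJong1996, 2.20, p. 61] -/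
theorem IsPurelyInseparableAlteration.topologicalKrullDim_eq {X' X : Scheme.{u}} [IsIntegral X]
    {k : Type u} [Field k] (f : X ⟶ Spec (.of k)) [LocallyOfFiniteType f] {φ : X' ⟶ X}
    (hφ : IsPurelyInseparableAlteration φ) : topologicalKrullDim X' = topologicalKrullDim X :=
  hφ.isAlteration.topologicalKrullDim_eq f

end Literature.AlgebraicGeometry.Resolution

end
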